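import Summits.BirchSwinnertonDyer.Rank1Residual.X2.IsogenyQuotientLine
import Summits.BirchSwinnertonDyer.Rank1Residual.X2.IsogenyLineType
import Summits.BirchSwinnertonDyer.Rank1Residual.X2.GreenbergVatsalInputs
import Summits.BirchSwinnertonDyer.Rank1Residual.X2.RankZeroExact
import Literature.NumberTheory.EllipticCurves.Wuthrich2014.ShaBoundProofs
import Literature.NumberTheory.EllipticCurves.AnalyticRankOrderProofs
import HarnessLib

/-!
# Class X2a WITHOUT the flag `GV00-mult-asserted`: GV CASE 1 from the two typed printed inputs,
# GV CASE 2 by the `p`-isogeny `E → E/Φ₀` and Cassels' invariance of `BSD(E,p)`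
# (cell `b2b-bsdres`, unit `b2b-bsdres-eisenstein-p2`, gen 18)

HONEST FRAMING (run/shared/lean/b2b/bsd-rank1-residual/, verbatim in every file): the goal of the
cell is to DELETE the COMBINATION-SHAPED residual classes of the Birch–Swinnerton-Dyer formula for
ALL analytic-rank `≤ 1` elliptic curves over `ℚ` — "full BSD formula for every rank `≤ 1` curve in
class `C`" assembled STRICTLY from published theorems — so that the rank-`≤ 1` remainder becomes
exactly the CONSTRUCTION-SHAPED classes, which are TYPED (missing-input `Prop`s), NOT attempted.
This is not "finishing BSD". Research route; NO CLAIM BEYOND STATED CLASSES; nothing here changes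
a label (the seat proposes, the referee rules). Theorems only; no definition, no named fact.

WHAT. Sub-cell X2a = `r_an = 0 ∧ ClassX2(E,p) ∧ GVPar(E,p)` (`p` odd, `p ‖ N`, `E[p]` reducible,
some rational line `Φ₀ ≤ E[p]` ramified-at-`p`-and-even (CASE 1) or unramified-at-`p`-and-odd
(CASE 2)). Its closure of record `X2.RankZero.targetA_of_published` takes the named fact
`GreenbergVatsal2000.lambdaMu_multiplicative_of_gvPar` (A63/A64, flag `GV00-mult-asserted`: GV's
Thm. (1.3) is printed for good ordinary `p`, the multiplicative case being the authors' assertion).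
Gens 8–17 rebuilt GV's proof at `p ‖ N` in the kernel for CASE 1, ending in
`X2.caseOne_clause_of_inputs` (registered facts A40/A41, A133, A135, A137, Greenberg 1999
Prop. 5.10 + the two TYPED printed inputs `X2.GVLiftingInput` (GV p. 28/30) and
`X2.GVAnalyticInput` (GV Thm. (3.11) + (28) + p. 43), nothing asserted). This file finishes the
job for the whole sub-cell:

* §1 `mazurMainConjectureAt_of_lineRamifiedEven` — CASE 1: Mazur's main conjecture at `(E,p)`
  (`X2.MazurMainConjectureAt`) from the per-curve clause of `caseOne_clause_of_inputs` and Wuthrich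
  2014 Thm. 16 (the derivation of `GreenbergVatsal2000.mainConjecture_{split,nonsplit}_of_gvPar`,
  run per curve); `bsdp_of_lineRamifiedEven_rankZero` — hence `BSD(E,p)` at `r_an = 0`
  (`X2.RankZero.bsdp_of_mazurMainConjectureAt_of_analyticRank_eq_zero`).
* §2 `bsdp_of_lineUnramifiedOdd_rankZero` — CASE 2 by GREENBERG–VATSAL'S OWN REDUCTION (p. 28:
  "`E' = E/Φ` … Thus, we may assume … `φ` is ramified and even"), performed at the level of
  `BSD(E,p)`: the quotient `E' = E/Φ₀` on a globally minimal model (`X2/IsogenyQuotientLine`) is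
  `ℚ`-isogenous to `E`, multiplicative at `p`, of analytic rank `0`, and carries the RAMIFIED-EVEN
  rational line `E[p]/Φ₀` (`X2/IsogenyLineType`, Tate line + Weil pairing) — so §1 gives
  `BSD(E',p)`, and `BSD(E,p)` follows by Cassels' isogeny invariance of the BSD quotient (Milne
  *ADT* I.7.3; registered named fact `bsdRHS_eq_of_isIsogenous`, tree theorem
  `Wuthrich2014.bsdp_of_isIsogenous`). No `λ`/`μ`/period comparison along the isogeny is needed in
  rank `0`.
* `bsdp_of_gvPar_rankZero` — both parity cases; the sequel `X2/GreenbergVatsalTargetAOfInputs.lean`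
  packages `X2.TargetA` / the class statement of record from these inputs, i.e. WITHOUT
  `lambdaMu_multiplicative_of_gvPar` / `lambda_muAnal_multiplicative_of_gvPar`.

What is STILL an input (honestly): `hLift`/`hAn` = `X2.GVLiftingInput`/`X2.GVAnalyticInput` at
every admissible CASE-1 datum (typed, per datum; their Literature filing is X2-GAP §22.7), the
registered named facts listed in the binders, and Cassels (`hCassels`). For `r_an = 1` (X2c) and
for the `λ`-clause of A64 itself in CASE 2 the isogeny needs in addition "`λ` is an isogeny
invariant" and the period comparison GV Cor. (3.8) — sequel.

References: [GreenbergVatsal2000] §2 p. 28, Thm. (1.3), §3 Cor. (3.8); [Wuthrich2014] Thm. 16;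
[MilneADT2006] Thm. I.7.3; [Miller2011LMS] Def. 1.1; HOME/b2b-bsdres-eisenstein-p2/X2-GAP.md §23.
-/

set_option autoImplicit false

noncomputable section

open scoped Classical MatrixGroups ModularForm

open PowerSeries NumberField IsDedekindDomain Field WeierstrassCurve CongruenceSubgroup
  Literature.NumberTheory.EllipticCurves Literature.NumberTheory.EllipticCurves.GreenbergVatsal2000
  Literature.NumberTheory.EllipticCurves.ModularForms
  Literature.NumberTheory.EllipticCurves.Wuthrich2014
  Literature.NumberTheory.EllipticCurves.SteinWuthrich2013
  Literature.NumberTheory.EllipticCurves.Rank1Residual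
  Literature.NumberTheory.EllipticCurves.Rank1Residual.Typed
  Summit.BirchSwinnertonDyer.Rank1Residual.X2.IsogenyQuotientLine
  Summit.BirchSwinnertonDyer.Rank1Residual.X2.IsogenyLineType

namespace Summit.BirchSwinnertonDyer.Rank1Residual.X2.GreenbergVatsalIsogenyReduction

/-! ## §1. CASE 1: Mazur's main conjecture and `BSD(E,p)` from the two typed inputs -/


/-- **CASE 1 ⟹ Mazur's main conjecture at `(E,p)`**: for `E/ℚ` globally minimal, `p ≠ 2`
multiplicative, and a rational line `Φ₀ ≤ E[p]` RAMIFIED at `p` and EVEN, `X2.MazurMainConjectureAt W p`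
holds — from the per-curve `λ/μ` clause `caseOne_clause_of_inputs` (registered facts + the typed
inputs `GVLiftingInput`/`GVAnalyticInput`), Greenberg 1999 Prop. 5.10 (`hG`: torsion, `char X = (f_E)`)
and Wuthrich 2014 Thm. 16 (`hWu`: `ϖL = ι(T^e g)`, `g ∈ char X`), by the unit argument of
`GreenbergVatsal2000.mainConjecture_{split,nonsplit}_of_gvPar` (`isUnit_of_mul_eq_of_order_map_eq`).
[cite: GreenbergVatsal2000, p. 20 (arXiv p. 4) and pp. 14–15] [cite: Wuthrich2014, Thm. 16 (p. 397)] -/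
theorem mazurMainConjectureAt_of_lineRamifiedEven
    (hT : Silverman1994_thmV53_tateUniformisation.{0})
    (hT' : Silverman1994_thmV53_corV54_tateUniformisation.{0})
    (hA : lambda_nonPrimitive_eq_add_sum_delta_multiplicative)
    (hB : datumSelmer_divisible_of_finite_torsionBy)
    (hF : datumStrictSelmer_lt_datumSelmer_of_split)
    (hG : Greenberg1999.prop510_isTorsion_hasUnitContent_of_gvPar)
    (hLift : ∀ (W : WeierstrassCurve ℚ) [W.IsGloballyMinimal] [W.IsElliptic] (p : ℕ) [Fact p.Prime]
      (κ : ZpExtension ℚ p) (S₀ : Finset (HeightOneSpectrum (𝓞 ℚ)))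
      (Φ₀ : AddSubgroup (W.geomTorsion (p : ℤ))) (hΦ : IsRationalLine W p Φ₀),
      p ≠ 2 → κ.IsCyclotomic → ¬ LineUnramifiedAt W p Φ₀ → LineEven W p Φ₀ →
      (∀ v ∈ S₀, ((p : ℕ) : 𝓞 ℚ) ∉ v.asIdeal) →
      (∀ v : HeightOneSpectrum (𝓞 ℚ), v ∉ S₀ → ((p : ℕ) : 𝓞 ℚ) ∉ v.asIdeal →
        W.HasGoodReductionAt v) →
      GVLiftingInput W p κ S₀ Φ₀ hΦ)
    (hAn : ∀ (W : WeierstrassCurve ℚ) [W.IsGloballyMinimal] [W.IsElliptic] (p : ℕ) [Fact p.Prime]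
      (κ : ZpExtension ℚ p) {N : ℕ} [NeZero N] (f : CuspForm (Gamma0 N) 2)
      (S₀ : Finset (HeightOneSpectrum (𝓞 ℚ)))
      (Φ₀ : AddSubgroup (W.geomTorsion (p : ℤ))) (hΦ : IsRationalLine W p Φ₀),
      p ≠ 2 → W.HasMultiplicativeReductionAtPrime p → κ.IsCyclotomic →
      ¬ LineUnramifiedAt W p Φ₀ → LineEven W p Φ₀ → IsNewformOf W f →
      (∀ v ∈ S₀, ((p : ℕ) : 𝓞 ℚ) ∉ v.asIdeal) →
      (∀ v : HeightOneSpectrum (𝓞 ℚ), v ∉ S₀ → ((p : ℕ) : 𝓞 ℚ) ∉ v.asIdeal →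
        W.HasGoodReductionAt v) →
      GVAnalyticInput W p κ f S₀ Φ₀ hΦ)
    (hWu : thm16_charIdeal_dvd_multiplicative_of_reducible)
    (W : WeierstrassCurve ℚ) [W.IsElliptic] [W.IsGloballyMinimal] (p : ℕ) [Fact p.Prime]
    (hp : p ≠ 2) (hmult : W.HasMultiplicativeReductionAtPrime p)
    {Φ₀ : AddSubgroup (W.geomTorsion (p : ℤ))} (hΦ : IsRationalLine W p Φ₀)
    (hram : ¬ LineUnramifiedAt W p Φ₀) (heven : LineEven W p Φ₀) :
    MazurMainConjectureAt W p := by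
  intro κ γ hκ hγ hγ' N _ f hf D ϖ hϖ
  have hpar : GVPar W p := ⟨Φ₀, hΦ, Or.inl ⟨hram, heven⟩⟩
  have hred : ¬ W.HasIrreducibleModPGaloisRep p := not_hasIrreducibleModPGaloisRep_of_isRationalLine hΦ
  obtain ⟨hX, fE, hchar, -⟩ := hG.of_mult W p hp hmult hpar hκ hγ D
  have hcl := caseOne_clause_of_inputs hT hT' hA hB hF hG hLift hAn W p hp hmult hΦ hram heven hκ hγ
    hf D ϖ hϖ fE hchar
  obtain ⟨-, hWns, hWsplit⟩ := hWu W p hp hmult hred hκ hγ hγ' hf D ϖ hϖ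
  refine ⟨hX, fE, hchar, fun hsplit L hL => ?_, fun hns L hL => ?_⟩
  · obtain ⟨g, hg, hιg⟩ := hWsplit hsplit L hL
    rw [hchar] at hg
    obtain ⟨c, hc⟩ := Ideal.mem_span_singleton'.mp hg
    obtain ⟨hub, hord⟩ := hcl.1 hsplit L hL (PowerSeries.X * g) hιg
    have hEq : (PowerSeries.X * fE) * c = PowerSeries.X * g := by rw [← hc]; ring
    have hcu : IsUnit c := isUnit_of_mul_eq_of_order_map_eq hEq hub hord
    refine ⟨hcu.unit, ?_⟩
    rw [IsUnit.unit_spec, hEq, hιg]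
  · obtain ⟨g, hg, hιg⟩ := hWns hns L hL
    rw [hchar] at hg
    obtain ⟨c, hc⟩ := Ideal.mem_span_singleton'.mp hg
    obtain ⟨hub, hord⟩ := hcl.2 hns L hL g hιg
    have hEq : fE * c = g := by rw [← hc, mul_comm]
    have hcu : IsUnit c := isUnit_of_mul_eq_of_order_map_eq hEq hub hord
    refine ⟨hcu.unit, ?_⟩
    rw [IsUnit.unit_spec, hEq, hιg]


/-- **CASE 1 at analytic rank `0` ⟹ `BSD(E,p)`** (`X2.RankZero.bsdp_of_mazurMainConjectureAt_of_analyticRank_eq_zero`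
on top of `mazurMainConjectureAt_of_lineRamifiedEven`; rank-`0` glue: Stein–Wuthrich Thm. 6.1,
height existence, Greenberg–Stevens `hGS`, GZK, modularity). [cite: SteinWuthrich2013, Thm. 6.1 (p. 20) and §4.2] -/
theorem bsdp_of_lineRamifiedEven_rankZero
    (hT : Silverman1994_thmV53_tateUniformisation.{0})
    (hT' : Silverman1994_thmV53_corV54_tateUniformisation.{0})
    (hA : lambda_nonPrimitive_eq_add_sum_delta_multiplicative)
    (hB : datumSelmer_divisible_of_finite_torsionBy)
    (hF : datumStrictSelmer_lt_datumSelmer_of_split)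
    (hG : Greenberg1999.prop510_isTorsion_hasUnitContent_of_gvPar)
    (hLift : ∀ (W : WeierstrassCurve ℚ) [W.IsGloballyMinimal] [W.IsElliptic] (p : ℕ) [Fact p.Prime]
      (κ : ZpExtension ℚ p) (S₀ : Finset (HeightOneSpectrum (𝓞 ℚ)))
      (Φ₀ : AddSubgroup (W.geomTorsion (p : ℤ))) (hΦ : IsRationalLine W p Φ₀),
      p ≠ 2 → κ.IsCyclotomic → ¬ LineUnramifiedAt W p Φ₀ → LineEven W p Φ₀ →
      (∀ v ∈ S₀, ((p : ℕ) : 𝓞 ℚ) ∉ v.asIdeal) →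
      (∀ v : HeightOneSpectrum (𝓞 ℚ), v ∉ S₀ → ((p : ℕ) : 𝓞 ℚ) ∉ v.asIdeal →
        W.HasGoodReductionAt v) →
      GVLiftingInput W p κ S₀ Φ₀ hΦ)
    (hAn : ∀ (W : WeierstrassCurve ℚ) [W.IsGloballyMinimal] [W.IsElliptic] (p : ℕ) [Fact p.Prime]
      (κ : ZpExtension ℚ p) {N : ℕ} [NeZero N] (f : CuspForm (Gamma0 N) 2)
      (S₀ : Finset (HeightOneSpectrum (𝓞 ℚ)))
      (Φ₀ : AddSubgroup (W.geomTorsion (p : ℤ))) (hΦ : IsRationalLine W p Φ₀),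
      p ≠ 2 → W.HasMultiplicativeReductionAtPrime p → κ.IsCyclotomic →
      ¬ LineUnramifiedAt W p Φ₀ → LineEven W p Φ₀ → IsNewformOf W f →
      (∀ v ∈ S₀, ((p : ℕ) : 𝓞 ℚ) ∉ v.asIdeal) →
      (∀ v : HeightOneSpectrum (𝓞 ℚ), v ∉ S₀ → ((p : ℕ) : 𝓞 ℚ) ∉ v.asIdeal →
        W.HasGoodReductionAt v) →
      GVAnalyticInput W p κ f S₀ Φ₀ hΦ)
    (hWu : thm16_charIdeal_dvd_multiplicative_of_reducible)
    (hJs : thm61_splitMultiplicative) (hJn : thm61_nonsplitMultiplicative)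
    (hHs : exists_isSplitMultCanonical) (hHn : exists_isMultCanonical)
    (hGZK : rank_eq_analyticRank_of_analyticRank_le_one) (hmod : hasEntireLFunction_rat)
    (hpar : nonempty_modularParametrizationData)
    (W : WeierstrassCurve ℚ) [W.IsElliptic] [W.IsGloballyMinimal] (p : ℕ) [Fact p.Prime]
    (hGS : greenberg_stevens (W := W) (p := p))
    (hp : p ≠ 2) (hmult : W.HasMultiplicativeReductionAtPrime p) (hr : W.analyticRank = 0)
    {Φ₀ : AddSubgroup (W.geomTorsion (p : ℤ))} (hΦ : IsRationalLine W p Φ₀)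
    (hram : ¬ LineUnramifiedAt W p Φ₀) (heven : LineEven W p Φ₀) : BSDp W p :=
  bsdp_of_mazurMainConjectureAt_of_analyticRank_eq_zero hJs hJn hHs hHn hGZK hmod hpar W p hGS hp
    hmult hr (mazurMainConjectureAt_of_lineRamifiedEven hT hT' hA hB hF hG hLift hAn hWu W p hp hmult
      hΦ hram heven)

/-! ## §2. CASE 2 at analytic rank `0`: through `E' = E/Φ₀` and Cassels -/


/-- **CASE 2 at analytic rank `0` ⟹ `BSD(E,p)`, by Greenberg–Vatsal's isogeny reduction.** For
`E/ℚ` globally minimal, `p ≠ 2` multiplicative, `r_an(E) = 0` and a rational line `Φ₀ ≤ E[p]`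
UNRAMIFIED at `p` and ODD: the quotient `E' = E/Φ₀` (globally minimal model,
`exists_isogeny_ker_eq_line`) is `ℚ`-isogenous to `E`, multiplicative at `p`
(`hasMultiplicativeReductionAtPrime_of_isIsogenous`), of analytic rank `0`
(`analyticRank_eq_of_isIsogenous'`), and has the RAMIFIED-EVEN rational line `E[p]/Φ₀`
(`exists_rationalLine_ramified_even_of_isogeny`); so `BSD(E',p)` by §1, and `BSD(E,p)` by Cassels'
isogeny invariance (`Wuthrich2014.bsdp_of_isIsogenous`, named fact `hCassels`; `Ш(E')` finite by
GZK, `L(E',1) ≠ 0` by `leadingLCoeff_ne_zero`). GV p. 28 ("`E' = E/Φ` … we may assume `φ` is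
ramified and even"); Milne *ADT* I.7.3. [cite: GreenbergVatsal2000, §2 p. 28]
[cite: MilneADT2006, Thm. I.7.3 and Remark I.7.4] -/
theorem bsdp_of_lineUnramifiedOdd_rankZero
    (hT : Silverman1994_thmV53_tateUniformisation.{0})
    (hT' : Silverman1994_thmV53_corV54_tateUniformisation.{0})
    (hA : lambda_nonPrimitive_eq_add_sum_delta_multiplicative)
    (hB : datumSelmer_divisible_of_finite_torsionBy)
    (hF : datumStrictSelmer_lt_datumSelmer_of_split)
    (hG : Greenberg1999.prop510_isTorsion_hasUnitContent_of_gvPar)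
    (hLift : ∀ (W : WeierstrassCurve ℚ) [W.IsGloballyMinimal] [W.IsElliptic] (p : ℕ) [Fact p.Prime]
      (κ : ZpExtension ℚ p) (S₀ : Finset (HeightOneSpectrum (𝓞 ℚ)))
      (Φ₀ : AddSubgroup (W.geomTorsion (p : ℤ))) (hΦ : IsRationalLine W p Φ₀),
      p ≠ 2 → κ.IsCyclotomic → ¬ LineUnramifiedAt W p Φ₀ → LineEven W p Φ₀ →
      (∀ v ∈ S₀, ((p : ℕ) : 𝓞 ℚ) ∉ v.asIdeal) →
      (∀ v : HeightOneSpectrum (𝓞 ℚ), v ∉ S₀ → ((p : ℕ) : 𝓞 ℚ) ∉ v.asIdeal →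
        W.HasGoodReductionAt v) →
      GVLiftingInput W p κ S₀ Φ₀ hΦ)
    (hAn : ∀ (W : WeierstrassCurve ℚ) [W.IsGloballyMinimal] [W.IsElliptic] (p : ℕ) [Fact p.Prime]
      (κ : ZpExtension ℚ p) {N : ℕ} [NeZero N] (f : CuspForm (Gamma0 N) 2)
      (S₀ : Finset (HeightOneSpectrum (𝓞 ℚ)))
      (Φ₀ : AddSubgroup (W.geomTorsion (p : ℤ))) (hΦ : IsRationalLine W p Φ₀),
      p ≠ 2 → W.HasMultiplicativeReductionAtPrime p → κ.IsCyclotomic →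
      ¬ LineUnramifiedAt W p Φ₀ → LineEven W p Φ₀ → IsNewformOf W f →
      (∀ v ∈ S₀, ((p : ℕ) : 𝓞 ℚ) ∉ v.asIdeal) →
      (∀ v : HeightOneSpectrum (𝓞 ℚ), v ∉ S₀ → ((p : ℕ) : 𝓞 ℚ) ∉ v.asIdeal →
        W.HasGoodReductionAt v) →
      GVAnalyticInput W p κ f S₀ Φ₀ hΦ)
    (hWu : thm16_charIdeal_dvd_multiplicative_of_reducible)
    (hJs : thm61_splitMultiplicative) (hJn : thm61_nonsplitMultiplicative)
    (hHs : exists_isSplitMultCanonical) (hHn : exists_isMultCanonical)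
    (hGZK : rank_eq_analyticRank_of_analyticRank_le_one) (hmod : hasEntireLFunction_rat)
    (hpar : nonempty_modularParametrizationData)
    (hCassels : bsdRHS_eq_of_isIsogenous)
    (hGS : ∀ (W : WeierstrassCurve ℚ) [W.IsElliptic] [W.IsGloballyMinimal] (p : ℕ) [Fact p.Prime],
      greenberg_stevens (W := W) (p := p))
    (W : WeierstrassCurve ℚ) [W.IsElliptic] [W.IsGloballyMinimal] (p : ℕ) [Fact p.Prime]
    (hp : p ≠ 2) (hmult : W.HasMultiplicativeReductionAtPrime p) (hr : W.analyticRank = 0)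
    {Φ₀ : AddSubgroup (W.geomTorsion (p : ℤ))} (hΦ : IsRationalLine W p Φ₀)
    (hu : LineUnramifiedAt W p Φ₀) (ho : LineOdd W p Φ₀) : BSDp W p := by
  obtain ⟨W', _, _, g, hker, -⟩ := exists_isogeny_ker_eq_line hΦ
  obtain ⟨Φ', hΦ', hram', heven'⟩ :=
    exists_rationalLine_ramified_even_of_isogeny hT hT' hp hmult hΦ hu ho g hker
  have hiso : IsIsogenous W W' := ⟨g⟩
  have hmult' : W'.HasMultiplicativeReductionAtPrime p :=
    hasMultiplicativeReductionAtPrime_of_isIsogenous hiso hmult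
  have hr' : W'.analyticRank = 0 := by rw [← analyticRank_eq_of_isIsogenous' hiso, hr]
  have h' : BSDp W' p := bsdp_of_lineRamifiedEven_rankZero hT hT' hA hB hF hG hLift hAn hWu hJs hJn
    hHs hHn hGZK hmod hpar W' p (hGS W' p) hp hmult' hr' hΦ' hram' heven'
  obtain ⟨-, hfin'⟩ := hGZK W' (by rw [hr']; exact zero_le_one)
  have hlead' : W'.leadingLCoeff ≠ 0 := W'.leadingLCoeff_ne_zero_holds (hmod W')
  exact bsdp_of_isIsogenous hCassels hiso hfin' hlead' h'

/-- **X2a pairs, both parity cases, analytic rank `0` ⟹ `BSD(E,p)`** (`GVPar`: excluded middle on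
the line type of the witness). [cite: GreenbergVatsal2000, Thm. (1.3) and §2 p. 28] -/
theorem bsdp_of_gvPar_rankZero
    (hT : Silverman1994_thmV53_tateUniformisation.{0})
    (hT' : Silverman1994_thmV53_corV54_tateUniformisation.{0})
    (hA : lambda_nonPrimitive_eq_add_sum_delta_multiplicative)
    (hB : datumSelmer_divisible_of_finite_torsionBy)
    (hF : datumStrictSelmer_lt_datumSelmer_of_split)
    (hG : Greenberg1999.prop510_isTorsion_hasUnitContent_of_gvPar)
    (hLift : ∀ (W : WeierstrassCurve ℚ) [W.IsGloballyMinimal] [W.IsElliptic] (p : ℕ) [Fact p.Prime]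
      (κ : ZpExtension ℚ p) (S₀ : Finset (HeightOneSpectrum (𝓞 ℚ)))
      (Φ₀ : AddSubgroup (W.geomTorsion (p : ℤ))) (hΦ : IsRationalLine W p Φ₀),
      p ≠ 2 → κ.IsCyclotomic → ¬ LineUnramifiedAt W p Φ₀ → LineEven W p Φ₀ →
      (∀ v ∈ S₀, ((p : ℕ) : 𝓞 ℚ) ∉ v.asIdeal) →
      (∀ v : HeightOneSpectrum (𝓞 ℚ), v ∉ S₀ → ((p : ℕ) : 𝓞 ℚ) ∉ v.asIdeal →
        W.HasGoodReductionAt v) →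
      GVLiftingInput W p κ S₀ Φ₀ hΦ)
    (hAn : ∀ (W : WeierstrassCurve ℚ) [W.IsGloballyMinimal] [W.IsElliptic] (p : ℕ) [Fact p.Prime]
      (κ : ZpExtension ℚ p) {N : ℕ} [NeZero N] (f : CuspForm (Gamma0 N) 2)
      (S₀ : Finset (HeightOneSpectrum (𝓞 ℚ)))
      (Φ₀ : AddSubgroup (W.geomTorsion (p : ℤ))) (hΦ : IsRationalLine W p Φ₀),
      p ≠ 2 → W.HasMultiplicativeReductionAtPrime p → κ.IsCyclotomic →
      ¬ LineUnramifiedAt W p Φ₀ → LineEven W p Φ₀ → IsNewformOf W f →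
      (∀ v ∈ S₀, ((p : ℕ) : 𝓞 ℚ) ∉ v.asIdeal) →
      (∀ v : HeightOneSpectrum (𝓞 ℚ), v ∉ S₀ → ((p : ℕ) : 𝓞 ℚ) ∉ v.asIdeal →
        W.HasGoodReductionAt v) →
      GVAnalyticInput W p κ f S₀ Φ₀ hΦ)
    (hWu : thm16_charIdeal_dvd_multiplicative_of_reducible)
    (hJs : thm61_splitMultiplicative) (hJn : thm61_nonsplitMultiplicative)
    (hHs : exists_isSplitMultCanonical) (hHn : exists_isMultCanonical)
    (hGZK : rank_eq_analyticRank_of_analyticRank_le_one) (hmod : hasEntireLFunction_rat)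
    (hpar : nonempty_modularParametrizationData)
    (hCassels : bsdRHS_eq_of_isIsogenous)
    (hGS : ∀ (W : WeierstrassCurve ℚ) [W.IsElliptic] [W.IsGloballyMinimal] (p : ℕ) [Fact p.Prime],
      greenberg_stevens (W := W) (p := p))
    (W : WeierstrassCurve ℚ) [W.IsElliptic] [W.IsGloballyMinimal] (p : ℕ) [Fact p.Prime]
    (hp : p ≠ 2) (hmult : W.HasMultiplicativeReductionAtPrime p) (hr : W.analyticRank = 0)
    (hgv : GVPar W p) : BSDp W p := by
  obtain ⟨Φ₀, hΦ, hcase⟩ := hgv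
  rcases hcase with ⟨hram, heven⟩ | ⟨hu, ho⟩
  · exact bsdp_of_lineRamifiedEven_rankZero hT hT' hA hB hF hG hLift hAn hWu hJs hJn hHs hHn hGZK hmod
      hpar W p (hGS W p) hp hmult hr hΦ hram heven
  · exact bsdp_of_lineUnramifiedOdd_rankZero hT hT' hA hB hF hG hLift hAn hWu hJs hJn hHs hHn hGZK hmod
      hpar hCassels hGS W p hp hmult hr hΦ hu ho

end Summit.BirchSwinnertonDyer.Rank1Residual.X2.GreenbergVatsalIsogenyReduction

end
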